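import Summits.BirchSwinnertonDyer.BirchSwinnertonDyer.Theorems.ErratumRoadFiveNonSurjCornerShape
import HarnessLib

/-!
# Route `ErratumRoadFive` (rung K2), crux `NonSurjCorner` (item stmt-BirchSwinnertonDyer-19065):
# THE SHAPE OF THE `p = 5` CORNER — the dichotomy `5Ns` ∕ `5S4` by `3 ∣ #G`, and the Cartan shape
# (normaliser of a SPLIT Cartan, Cartan character unramified outside the additive primes, `5` split in
# the Cartan field, Eisenstein over it) on the `3 ∤ #G` side
# (cell `bsd-stepL`, seat `bsd-stepL-corner5-p2` g2, WIDTH-LEVER lane B; `--supports stmt-BirchSwinnertonDyer-19065 --as helper`)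

WHY THIS FILE. The sibling `ErratumRoadFiveNonSurjCornerShape.lean` gives the structure of every corner pair
at `p ≥ 7` (Serre's Prop. 17 for a split half-Cartan inertia needs `p ≠ 5`: at `p = 5` the projective image
may be octahedral). The `p = 5` branch of the crux (`stub_corner5`; the whole census corner: 64 class-pairs
`N < 5·10⁵`, Sutherland images `5Ns` ×12 and `5S4` ×52) splits by ONE group-theoretic bit:

* `3 ∤ #G` (`G = Φ(ρ̄_{E,5}(Γ_ℚ))`): then the engine of Prop. 17 (tree theorem
  `Serre1972.eq_top_or_borel_or_normalizer_cartan`, whose non-abelian case accepts «`3 ∤ |G|`» in place of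
  «`p ≠ 5`») applies, and EVERYTHING of the `p ≥ 7` file holds: `G ≤ N(C)`, `G ⊄ C` for the SPLIT Cartan
  `C = P (* 0; 0 *) P⁻¹` of the inertia torus at `5` (Prop. 14, `p ≥ 5`), `5 ∤ #G`, the inertia of every
  prime above `5` inside `C`; the Cartan subgroup `U ≤ Γ_ℚ` is open of index `2`, contains the inertia
  groups above `5`, above every multiplicative and every good `ℓ ≠ 5`, and the normaliser of each inertia
  group above `5` (so `5` SPLITS in the quadratic Cartan field `K`), and `E[5]` has two `U`-stable lines
  (`5` is an Eisenstein prime of `E/K`). This is the `5Ns` sub-corner (`#N(C_s(5)) = 32`, a `2`-group).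
* `3 ∣ #G`: the octahedral sub-corner `5S4` (not treated: no Cartan structure; recorded in the docstring of
  `NonSurjCorner.shape_five_or_three_dvd`).

* §1 `exists_splitCartan_normalizer_of_not_three_dvd` — the shape theorem at any prime `p ≥ 5` under `3 ∤ #G`.
* §2 `normalizer_inertia_le_cartanSubgroup_of_five_le` — `p ≥ 5` version of the sibling's §4b (there stated
  for `p ≥ 7` only); `dvd_frobeniusTrace_of_frobenius_not_mem_cartanSubgroup` — the CM-like signature
  `a_ℓ ≡ 0 (mod p)` at the good primes `ℓ` inert in the Cartan field (trace-compatible frames).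
* §3 `NonSurjCorner.shape_five_of_not_three_dvd`, `NonSurjCorner.shape_five_or_three_dvd` — at the crux's
  `p = 5` hypotheses (`ClassX11b W 5`, `¬ Surj W 5`).

HONEST FRAMING: structure theorems about Galois images; nothing here proves the crux or a registered stub;
BSD is proved for no class; nothing is booked. No definition, no named fact, no `sorry`.

References: [Serre1972] §2.2 Prop. 14, §2.4 Prop. 15, §2.6, §2.7 Prop. 17, §5.2 (iii)–(iv), §5.4;
tree files `ErratumRoadFiveNonSurjCornerShape`, `GaloisImage/MultiplicativeCartanNormalizer`,
`SerreCartanSubgroupsGL2FpProofs` (`eq_top_or_borel_or_normalizer_cartan`), `SerreProp14GL2Fp`.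
-/
set_option linter.dupNamespace false -- `Summit.BirchSwinnertonDyer.BirchSwinnertonDyer` (summit = problem), tree-wide
noncomputable section
open scoped Classical NumberField
open IsDedekindDomain Field Matrix

namespace Summit.BirchSwinnertonDyer.BirchSwinnertonDyer.Theorems.CornerShape

open WeierstrassCurve NumberField Rat.HeightOneSpectrum
  Literature.NumberTheory.EllipticCurves Literature.NumberTheory.GaloisRepresentations
  Literature.NumberTheory.GaloisRepresentations.Serre1972
  Literature.NumberTheory.EllipticCurves.Rank1Residual
  Summit.BirchSwinnertonDyer.Rank1Residual Summit.BirchSwinnertonDyer.Rank1Residual.GaloisImage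

variable (W : WeierstrassCurve ℚ) [W.IsElliptic] (p : ℕ) [hp : Fact p.Prime]

section Frame

variable (Φ : Multiplicative (AddAut (geomTorsion W p)) ≃* GL (Fin 2) (ZMod p))
  (e : geomTorsion W p ≃+ (Fin 2 → ZMod p))
  (he : ∀ (g : Multiplicative (AddAut (geomTorsion W p))) (x : geomTorsion W p),
    e (Multiplicative.toAdd g x) =
      ((Φ g : GL (Fin 2) (ZMod p)) : Matrix (Fin 2) (Fin 2) (ZMod p)) *ᵥ e x)

include he

/-! ### §1. The shape theorem at `p ≥ 5` under `3 ∤ #G` -/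

/-- **THE SHAPE OF THE CORNER at `p ≥ 5` when `3 ∤ #G`.** For `W/ℚ` elliptic, `p ≥ 5` multiplicative,
`E[p]` irreducible, `ρ̄_{E,p}` NOT onto, a frame `Φ`, and `3 ∤ #G` (`G = Φ(ρ̄(Γ_ℚ))`; at `p = 5` this
excludes exactly the octahedral image `5S4`): some `P ∈ GL₂(𝔽_p)` has `P (1 0; 0 *) P⁻¹ ≤ G ≤ N(C)`,
`G ⊄ C` for the SPLIT Cartan `C = P (* 0; 0 *) P⁻¹`, `p ∤ #G`, and the inertia image of EVERY prime
above `p` inside `C`. Proof: `p ∤ #G` (Prop. 15); the inertia at `p` is a split half-Cartan subgroup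
`≤ G` (`GaloisImage.exists_halfSplitCartan_eq_inertia_image_of_mult`); the ENGINE of Prop. 17
(`eq_top_or_borel_or_normalizer_cartan`, n° 2.6 with «`3 ∤ |G|`») gives `G = GL₂` (no: `¬Surj`), Borel
(no: `Irr`) or `G ≤ N(C')`; `G ⊄ C'` by complex conjugation (`exists_le_eigenvectorStabilizer_of_le_cartan`);
`C' = C` by Prop. 14 (`p ≥ 5`). [cite: Serre1972, §2.2 Prop. 14, §2.4 Prop. 15, §2.6, §2.7 Prop. 17, §5.4] -/
theorem exists_splitCartan_normalizer_of_not_three_dvd (h5 : 5 ≤ p) (hmult : Mult W p)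
    (hirr : Irr W p) (hns : ¬ Surj W p)
    (h3 : ¬ 3 ∣ Nat.card ((galoisRepTorsion W p).range.map Φ.toMonoidHom)) :
    ∃ P : GL (Fin 2) (ZMod p),
      halfSplitCartan P ≤ (galoisRepTorsion W p).range.map Φ.toMonoidHom ∧
      (galoisRepTorsion W p).range.map Φ.toMonoidHom ≤
          Subgroup.normalizer (splitCartan P : Set (GL (Fin 2) (ZMod p))) ∧
      ¬ (galoisRepTorsion W p).range.map Φ.toMonoidHom ≤ splitCartan P ∧
      ¬ p ∣ Nat.card ((galoisRepTorsion W p).range.map Φ.toMonoidHom) ∧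
      ∀ (v : HeightOneSpectrum (𝓞 ℚ)), (primesEquiv v : ℕ) = p →
        ∀ 𝔏 ∈ v.primesAbove,
          ((𝔏.inertia (absoluteGaloisGroup ℚ)).map (galoisRepTorsion W p)).map Φ.toMonoidHom ≤
            splitCartan P := by
  have hpp : p.Prime := hp.out
  have hp2 : p ≠ 2 := by omega
  set ρ := galoisRepTorsion W p with hρ
  set G : Subgroup (GL (Fin 2) (ZMod p)) := ρ.range.map Φ.toMonoidHom with hGdef
  have hGtop : G ≠ ⊤ := fun h ↦ hns ((map_range_galoisRepTorsion_eq_top_iff W p Φ).mp h)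
  have hpG : ¬ p ∣ Nat.card G :=
    not_dvd_card_of_not_hasSurjectiveModNGaloisRep W p Φ e he hirr hns
  -- the inertia torus at `p`
  obtain ⟨v, hv⟩ : ∃ v : HeightOneSpectrum (𝓞 ℚ), (primesEquiv v : ℕ) = p :=
    ⟨primesEquiv.symm ⟨p, hpp⟩, by rw [Equiv.apply_symm_apply]⟩
  obtain ⟨𝔏₀, h𝔏₀⟩ := v.primesAbove_nonempty
  obtain ⟨P, hP⟩ :=
    GaloisImage.exists_halfSplitCartan_eq_inertia_image_of_mult W p Φ e he hp2 hmult hpG hv h𝔏₀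
  have hIle : ∀ {𝔏 : Ideal (absIntegers (𝓞 ℚ) ℚ)},
      ((𝔏.inertia (absoluteGaloisGroup ℚ)).map ρ).map Φ.toMonoidHom ≤ G := fun {𝔏} ↦
    Subgroup.map_mono (show (𝔏.inertia (absoluteGaloisGroup ℚ)).map ρ ≤ ρ.range from
      fun x ⟨τ, _, hτ⟩ ↦ ⟨τ, hτ⟩)
  have hHle : halfSplitCartan P ≤ G := hP ▸ hIle
  -- a non-scalar element of `G`: `y = P diag(1, u₀) P⁻¹`
  obtain ⟨u₀, hu₀⟩ := exists_units_ne_one hp2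
  have hyG : (MulAut.conj P).toMonoidHom (halfDiagonalHom u₀) ∈ G :=
    hHle ⟨halfDiagonalHom u₀, by rw [← range_halfDiagonalHom]; exact ⟨u₀, rfl⟩, rfl⟩
  -- the engine of Prop. 17 with «`3 ∤ |G|`»
  have hres := eq_top_or_borel_or_normalizer_cartan G hp2 (exists_mem_map_range_det_eq W p Φ e he)
    (y := ⟨_, hyG⟩) (conj_halfDiagonalHom_ne_smul_one P hu₀) (fun _ _ ↦ Or.inr h3)
  obtain ⟨c₀, hc₀G, hc₀, hc₀det⟩ := exists_conj_mem_map_range W p Φ e he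
  rcases hres with htop | ⟨w, hw, hB⟩ | ⟨C, hC, hGN⟩
  · exact absurd htop hGtop
  · exact absurd hB (not_le_eigenvectorStabilizer_of_hasIrreducibleModPGaloisRep W p Φ e he hirr hw)
  · have hGC : ¬ G ≤ C := fun hGC ↦ by
      obtain ⟨w, hw, hB⟩ := exists_le_eigenvectorStabilizer_of_le_cartan hp2 hC hGC hc₀G hc₀ hc₀det
      exact not_le_eigenvectorStabilizer_of_hasIrreducibleModPGaloisRep W p Φ e he hirr hw hB
    have hCeq : C = splitCartan P :=
      eq_splitCartan_of_halfSplitCartan_le_normalizer hC h5 (hHle.trans hGN)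
    subst hCeq
    refine ⟨P, hHle, hGN, hGC, hpG, fun v' hv' 𝔏 h𝔏 ↦ ?_⟩
    obtain ⟨P', hP'⟩ :=
      GaloisImage.exists_halfSplitCartan_eq_inertia_image_of_mult W p Φ e he hp2 hmult hpG hv' h𝔏
    rw [hP']
    exact prop14_halfSplitCartan hC h5 (hP' ▸ (hIle.trans hGN))

/-! ### §2. `p` splits in the Cartan field (`p ≥ 5` version) -/

/-- **The normaliser of each inertia group above `p` lies in `U`** (hence the decomposition group:
`p` SPLITS in the Cartan field) — the sibling's `normalizer_inertia_le_cartanSubgroup` with `p ≥ 7`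
weakened to `p ≥ 5` (only `p ≠ 2` and Prop. 14's `p ≥ 5` are used). [cite: Serre1972, §2.2 Prop. 14; §1.12 Cor.] -/
theorem normalizer_inertia_le_cartanSubgroup_of_five_le (h5 : 5 ≤ p) (hmult : Mult W p)
    {P : GL (Fin 2) (ZMod p)}
    (hGN : (galoisRepTorsion W p).range.map Φ.toMonoidHom ≤
      Subgroup.normalizer (splitCartan P : Set (GL (Fin 2) (ZMod p))))
    (hG : ¬ p ∣ Nat.card ((galoisRepTorsion W p).range.map Φ.toMonoidHom))
    {v : HeightOneSpectrum (𝓞 ℚ)} (hv : (primesEquiv v : ℕ) = p)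
    {𝔏 : Ideal (absIntegers (𝓞 ℚ) ℚ)} (h𝔏 : 𝔏 ∈ v.primesAbove) {g : absoluteGaloisGroup ℚ}
    (hg : ∀ τ ∈ 𝔏.inertia (absoluteGaloisGroup ℚ), g * τ * g⁻¹ ∈ 𝔏.inertia (absoluteGaloisGroup ℚ)) :
    g ∈ ((splitCartan P).comap Φ.toMonoidHom).comap (galoisRepTorsion W p) := by
  have hp2 : p ≠ 2 := by omega
  obtain ⟨u, hu⟩ := exists_units_ne_one hp2
  set ρ := galoisRepTorsion W p with hρ
  obtain ⟨P', hP'⟩ :=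
    GaloisImage.exists_halfSplitCartan_eq_inertia_image_of_mult W p Φ e he hp2 hmult hG hv h𝔏
  have hIle : ((𝔏.inertia (absoluteGaloisGroup ℚ)).map ρ).map Φ.toMonoidHom ≤
      ρ.range.map Φ.toMonoidHom :=
    Subgroup.map_mono (show (𝔏.inertia (absoluteGaloisGroup ℚ)).map ρ ≤ ρ.range from
      fun x ⟨τ, _, hτ⟩ ↦ ⟨τ, hτ⟩)
  have hPP' : splitCartan P = splitCartan P' :=
    eq_splitCartan_of_halfSplitCartan_le_normalizer (splitCartan_mem_cartanSubgroups P) h5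
      (hP' ▸ (hIle.trans hGN))
  have hnorm : ∀ h ∈ halfSplitCartan P', Φ (ρ g) * h * (Φ (ρ g))⁻¹ ∈ halfSplitCartan P' := by
    intro h hh
    rw [← hP'] at hh ⊢
    obtain ⟨x, ⟨τ, hτ, rfl⟩, rfl⟩ := hh
    refine ⟨ρ (g * τ * g⁻¹), ⟨g * τ * g⁻¹, hg τ hτ, rfl⟩, ?_⟩
    simp only [MulEquiv.coe_toMonoidHom, map_mul, map_inv, hρ]
  rw [mem_comap_cartan_iff, hPP']
  exact mem_splitCartan_of_forall_conj_mem_halfSplitCartan hu hnorm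

omit he in
/-- **The CM-like signature of the corner: `a_ℓ(E) ≡ 0 (mod p)` at every good prime `ℓ ≠ p` whose
Frobenius lies OUTSIDE the Cartan subgroup `U`** (i.e. `ℓ` inert in the quadratic Cartan field `K`): the
elements of `N(C) ∖ C` have trace zero (Serre §4.2, proof of Lemme 3; tree theorem
`natCast_dvd_frobeniusTrace_of_not_mem_comap_cartan`, for a trace-compatible frame `Φ` — such frames
exist, `exists_frame_galoisRepTorsion_rat`). A decidable per-curve consequence of the shape theorems
(`p ≥ 7`, or `p = 5` with `3 ∤ #G`): half of the good primes have `a_ℓ ≡ 0 (mod p)`.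
[cite: Serre1972, §4.2, proof of Lemme 3] -/
theorem dvd_frobeniusTrace_of_frobenius_not_mem_cartanSubgroup [W.IsGloballyMinimal] (hp2 : p ≠ 2)
    (hΦ : letI : Module (ZMod p) (geomTorsion W p) := AddSubgroup.torsionBy.zmodModule
      ∀ g : Multiplicative (AddAut (geomTorsion W p)),
        Matrix.trace ((Φ g : GL (Fin 2) (ZMod p)) : Matrix (Fin 2) (Fin 2) (ZMod p)) =
          LinearMap.trace (ZMod p) (geomTorsion W p)
            ((Multiplicative.toAdd g).toAddMonoidHom.toZModLinearMap p))
    {P : GL (Fin 2) (ZMod p)}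
    (hGN : (galoisRepTorsion W p).range.map Φ.toMonoidHom ≤
      Subgroup.normalizer (splitCartan P : Set (GL (Fin 2) (ZMod p))))
    {ℓ : ℕ} [Fact ℓ.Prime] (hℓp : ℓ ≠ p) (hgood : Good W ℓ)
    {v : HeightOneSpectrum (𝓞 ℚ)} (hv : (primesEquiv v : ℕ) = ℓ)
    {𝔓 : Ideal (absIntegers (𝓞 ℚ) ℚ)} (h𝔓 : 𝔓 ∈ v.primesAbove)
    {σ : absoluteGaloisGroup ℚ} (hσ : IsArithFrobAt (𝓞 ℚ) σ 𝔓)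
    (hσU : σ ∉ ((splitCartan P).comap Φ.toMonoidHom).comap (galoisRepTorsion W p)) :
    (p : ℤ) ∣ W.frobeniusTrace ℓ :=
  natCast_dvd_frobeniusTrace_of_not_mem_comap_cartan W p Φ hΦ (splitCartan_mem_cartanSubgroups P)
    (fun _ ↦ hp2) hGN hℓp hgood hv h𝔓 hσ hσU

end Frame

/-! ### §3. At the crux's `p = 5` branch -/

/-- **THE SHAPE OF THE `p = 5` CORNER OFF THE OCTAHEDRAL IMAGE** (crux `NonSurjCorner` ∕ `stub_corner5`:
`ClassX11b W 5`, `¬ Surj W 5`, and `3 ∤ #Φ(ρ̄_{E,5}(Γ_ℚ))` — the `5Ns` sub-corner): for every frame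
`(Φ, e)` some `P ∈ GL₂(𝔽₅)` gives, with `C = P (* 0; 0 *) P⁻¹`, `U = ρ̄⁻¹(Φ⁻¹(C))`: (1) `G ≤ N(C)`,
`G ⊄ C`, `5 ∤ #G`; (2) `U` open of index `2` (the quadratic Cartan field `K`); (3) `U` contains the
inertia groups above `5` and their normalisers (`5` SPLITS in `K`), above every multiplicative `ℓ ≠ 5`
and every good `ℓ` (the Cartan character ramifies only at additive primes); (4) the lines
`e⁻¹(𝔽₅ · P eᵢ)` are `U`-stable — `5` is an Eisenstein prime of `E/K`. Nothing about BSD is claimed.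
[cite: Serre1972, §2.2 Prop. 14, §2.6, §2.7 Prop. 17, §5.4 proof of Prop. 21] -/
theorem NonSurjCorner.shape_five_of_not_three_dvd (W : WeierstrassCurve ℚ) [W.IsElliptic]
    [W.IsGloballyMinimal] [Fact (Nat.Prime 5)] (hX : ClassX11b W 5) (hns : ¬ Surj W 5)
    (Φ : Multiplicative (AddAut (geomTorsion W 5)) ≃* GL (Fin 2) (ZMod 5))
    (e : geomTorsion W 5 ≃+ (Fin 2 → ZMod 5))
    (he : ∀ (g : Multiplicative (AddAut (geomTorsion W 5))) (x : geomTorsion W 5),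
      e (Multiplicative.toAdd g x) =
        ((Φ g : GL (Fin 2) (ZMod 5)) : Matrix (Fin 2) (Fin 2) (ZMod 5)) *ᵥ e x)
    (h3 : ¬ 3 ∣ Nat.card ((galoisRepTorsion W 5).range.map Φ.toMonoidHom)) :
    ∃ P : GL (Fin 2) (ZMod 5),
      ((galoisRepTorsion W 5).range.map Φ.toMonoidHom ≤
          Subgroup.normalizer (splitCartan P : Set (GL (Fin 2) (ZMod 5))) ∧
        ¬ (galoisRepTorsion W 5).range.map Φ.toMonoidHom ≤ splitCartan P ∧
        ¬ 5 ∣ Nat.card ((galoisRepTorsion W 5).range.map Φ.toMonoidHom)) ∧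
      (IsOpen ((((splitCartan P).comap Φ.toMonoidHom).comap (galoisRepTorsion W 5) :
          Subgroup (absoluteGaloisGroup ℚ)) : Set (absoluteGaloisGroup ℚ)) ∧
        (((splitCartan P).comap Φ.toMonoidHom).comap (galoisRepTorsion W 5)).index = 2) ∧
      (∀ (v : HeightOneSpectrum (𝓞 ℚ)), (primesEquiv v : ℕ) = 5 → ∀ 𝔏 ∈ v.primesAbove,
        𝔏.inertia (absoluteGaloisGroup ℚ) ≤
          ((splitCartan P).comap Φ.toMonoidHom).comap (galoisRepTorsion W 5) ∧
        ∀ g : absoluteGaloisGroup ℚ, (∀ τ ∈ 𝔏.inertia (absoluteGaloisGroup ℚ),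
            g * τ * g⁻¹ ∈ 𝔏.inertia (absoluteGaloisGroup ℚ)) →
          g ∈ ((splitCartan P).comap Φ.toMonoidHom).comap (galoisRepTorsion W 5)) ∧
      (∀ (ℓ : ℕ) [Fact ℓ.Prime], ℓ ≠ 5 → (Mult W ℓ ∨ Good W ℓ) →
        ∀ (v : HeightOneSpectrum (𝓞 ℚ)), (primesEquiv v : ℕ) = ℓ → ∀ 𝔓 ∈ v.primesAbove,
          𝔓.inertia (absoluteGaloisGroup ℚ) ≤
            ((splitCartan P).comap Φ.toMonoidHom).comap (galoisRepTorsion W 5)) ∧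
      (∀ σ ∈ ((splitCartan P).comap Φ.toMonoidHom).comap (galoisRepTorsion W 5),
        ∀ (i : Fin 2) (x : geomTorsion W 5),
          (∃ a : ZMod 5, e x = a • (P : Matrix (Fin 2) (Fin 2) (ZMod 5)).col i) →
            ∃ b : ZMod 5, e (σ • x) = b • (P : Matrix (Fin 2) (Fin 2) (ZMod 5)).col i) := by
  obtain ⟨P, -, hGN, hGC, hpG, hI⟩ := exists_splitCartan_normalizer_of_not_three_dvd W 5 Φ e he
    (le_refl 5) hX.2.2.1 hX.2.2.2 hns h3
  refine ⟨P, ⟨hGN, hGC, hpG⟩, cartanSubgroup_index_two W 5 Φ (by norm_num) hGN hGC,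
    fun v hv 𝔏 h𝔏 ↦ ⟨inertia_le_cartanSubgroup_at W 5 Φ hI hv h𝔏, fun g hg ↦
      normalizer_inertia_le_cartanSubgroup_of_five_le W 5 Φ e he (le_refl 5) hX.2.2.1 hGN hpG hv
        h𝔏 hg⟩,
    fun ℓ _ hℓ hred v hv 𝔓 h𝔓 ↦ ?_,
    fun σ hσ i x hx ↦ cartanSubgroup_stable_lines W 5 Φ e he hσ i x hx⟩
  rcases hred with hmult | hgood
  · exact inertia_le_cartanSubgroup_mult W 5 Φ hpG hℓ hmult hv h𝔓
  · exact inertia_le_cartanSubgroup_good W 5 Φ hℓ hgood hv h𝔓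

/-- **THE `p = 5` DICHOTOMY OF THE CORNER** (crux `NonSurjCorner` ∕ `stub_corner5`): at every pair with
`ClassX11b W 5` and `¬ Surj W 5`, for every frame `(Φ, e)`, EITHER `3 ∣ #Φ(ρ̄_{E,5}(Γ_ℚ))` (the octahedral
sub-corner `5S4`: projective image `𝔖₄`; 52 of the 64 census pairs; no Cartan structure) OR the image lies
in the normaliser of a SPLIT Cartan subgroup without lying in it (the `5Ns` sub-corner, with all of
`NonSurjCorner.shape_five_of_not_three_dvd`: quadratic Cartan field `K` unramified outside the additive
primes, `5` split in `K`, `E/K` with two `K`-rational `5`-isogenies). [cite: Serre1972, §2.6, §2.7 Prop. 17] -/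
theorem NonSurjCorner.shape_five_or_three_dvd (W : WeierstrassCurve ℚ) [W.IsElliptic]
    [W.IsGloballyMinimal] [Fact (Nat.Prime 5)] (hX : ClassX11b W 5) (hns : ¬ Surj W 5)
    (Φ : Multiplicative (AddAut (geomTorsion W 5)) ≃* GL (Fin 2) (ZMod 5))
    (e : geomTorsion W 5 ≃+ (Fin 2 → ZMod 5))
    (he : ∀ (g : Multiplicative (AddAut (geomTorsion W 5))) (x : geomTorsion W 5),
      e (Multiplicative.toAdd g x) =
        ((Φ g : GL (Fin 2) (ZMod 5)) : Matrix (Fin 2) (Fin 2) (ZMod 5)) *ᵥ e x) :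
    3 ∣ Nat.card ((galoisRepTorsion W 5).range.map Φ.toMonoidHom) ∨
      ∃ P : GL (Fin 2) (ZMod 5),
        halfSplitCartan P ≤ (galoisRepTorsion W 5).range.map Φ.toMonoidHom ∧
        (galoisRepTorsion W 5).range.map Φ.toMonoidHom ≤
            Subgroup.normalizer (splitCartan P : Set (GL (Fin 2) (ZMod 5))) ∧
        ¬ (galoisRepTorsion W 5).range.map Φ.toMonoidHom ≤ splitCartan P := by
  by_cases h3 : 3 ∣ Nat.card ((galoisRepTorsion W 5).range.map Φ.toMonoidHom)
  · exact Or.inl h3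
  · obtain ⟨P, hHle, hGN, hGC, -⟩ := exists_splitCartan_normalizer_of_not_three_dvd W 5 Φ e he
      (le_refl 5) hX.2.2.1 hX.2.2.2 hns h3
    exact Or.inr ⟨P, hHle, hGN, hGC⟩

end Summit.BirchSwinnertonDyer.BirchSwinnertonDyer.Theorems.CornerShape

end
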